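import Summits.CriticalPhenomena.PercolationContinuityZ3.Theorems.PercNearOneGluingNoHeavyLowerTailSahiOneStepPivot
import HarnessLib

/-!
# One-step certificate, part 2/3: the TOWER LEMMA, the reduction identity (†), and the splitting of the main part `M`

Support file (prover prim-ineq-prove-3 gen 14; `--supports stmt-CriticalPhenomena-4575`; memo `run/shared/lean/prim/prim-ineq-prove-3/FINDING-G14-ONESTEP-THRESHOLD.md` §1).
No definitions, no named facts, no sorries.
* `osP_tower` — for `H` determined by `F` and `e ∉ F ∪ K`: `P_K(f,g) = p_e²P_K(f¹,g¹) + q_e²P_K(f⁰,g⁰) + p_eq_e·P_{K∪e}(f,g)`;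
* `osP_insert_eq` — (†) `P_{K∪e}(f,g) = P_K(f¹,g⁰) + P_K(f⁰,g¹) + Σ_{x⊆K} D(u^x v^x)` (any `H`);
* `osM_insert_eq` — the same splitting for `M`: `M_{K∪e}(f,g) = M_K(f¹,g⁰) + M_K(f⁰,g¹) + Σ_{x⊆K} m′(u^x, v^x)` (bilinearity of `m′`;
  the `n`-terms match level by level) — the algebraic heart of the one-step identity `P_K = M_K + Σ d(u,v) + …`.
-/

noncomputable section

namespace Summit.CriticalPhenomena.PercolationContinuityZ3.Theorems

namespace SahiOneStep

open Literature.Combinatorics.Sahi2008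
open Literature.Probability.Percolation (DeterminedBy determinedBy_iff)
open Literature.Probability.Percolation.DecisionTree (ind ind_of_mem ind_of_not_mem ind_nonneg)
open Literature.Probability.Percolation.BHK2006 (weight weight_nonneg blockFubini harris)
open Literature.Probability.LatticeModels (prodBernoulli sahiE3 sahiE3_def)
open SahiCdd (sec ex_congr' ex_lin2 ex_lin4 ex_split ex_mul_split sec_insert_of_not_mem sec_insert_insert
  sec_comp_insert sec_comp_sdiff sec_apply_insert sec_apply_sdiff monotone_sec dep_insert dep_sdiff ex_mul_le_ex_mul)

variable {ι : Type*} [Fintype ι] [DecidableEq ι]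

/-! ## The tower lemma and the reduction identity (†) -/

/-- **TOWER LEMMA** for a first event `H` determined by `F`.  For `e ∉ F ∪ K`:
`P_K(f,g) = p_e² P_K(f¹,g¹) + q_e² P_K(f⁰,g⁰) + p_e q_e P_{K ∪ {e}}(f,g)` (`f¹ = f(insert e ·)`, `f⁰ = f(· ∖ {e})`). [this work] -/
theorem osP_tower (p : ι → unitInterval) {H : Set (Set ι)} {F K : Finset ι} (hH : DeterminedBy H (F : Set ι))
    {e : ι} (he : e ∉ F) (heK : e ∉ K) (f g : Set ι → ℝ) :
    osP p H K f g =
      (p e : ℝ) ^ 2 * osP p H K (fun ω => f (insert e ω)) (fun ω => g (insert e ω))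
      + (1 - p e) ^ 2 * osP p H K (fun ω => f (ω \ {e})) (fun ω => g (ω \ {e}))
      + (p e : ℝ) * (1 - p e) * osP p H (insert e K) f g := by
  unfold osP
  have hdisj : Disjoint K.powerset (K.powerset.image (insert e)) := by
    rw [Finset.disjoint_left]
    intro x hx hx'
    obtain ⟨y, -, rfl⟩ := Finset.mem_image.1 hx'
    exact heK (Finset.mem_powerset.1 hx (Finset.mem_insert_self e y))
  have hinj : Set.InjOn (insert e) (K.powerset : Set (Finset ι)) := by
    intro x hx y hy hxy
    have hxe : e ∉ x := fun h => heK (Finset.mem_powerset.1 (Finset.mem_coe.1 hx) h)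
    have hye : e ∉ y := fun h => heK (Finset.mem_powerset.1 (Finset.mem_coe.1 hy) h)
    rw [← Finset.erase_insert hxe, hxy, Finset.erase_insert hye]
  rw [Finset.powerset_insert, Finset.sum_union hdisj, Finset.sum_image hinj]
  rw [Finset.mul_sum, Finset.mul_sum, mul_add, Finset.mul_sum, Finset.mul_sum, ← Finset.sum_add_distrib,
    ← Finset.sum_add_distrib, ← Finset.sum_add_distrib]
  refine Finset.sum_congr rfl fun x hx => ?_
  have hxK : x ⊆ K := Finset.mem_powerset.1 hx
  have hex : e ∉ x := fun h => heK (hxK h)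
  have heKx : e ∉ K \ x := fun h => heK (Finset.sdiff_subset h)
  have hc1 : insert e K \ x = insert e (K \ x) := Finset.insert_sdiff_of_notMem K hex
  have hc2 : insert e K \ insert e x = K \ x := by
    ext i
    simp only [Finset.mem_sdiff, Finset.mem_insert]
    constructor
    · rintro ⟨h | h, h2⟩
      · exact absurd (Or.inl h) h2
      · exact ⟨h, fun h3 => h2 (Or.inr h3)⟩
    · rintro ⟨h1, h2⟩
      exact ⟨Or.inr h1, fun h3 => h3.elim (fun h4 => heK (h4 ▸ h1)) h2⟩
  rw [hc1, hc2, sec_insert_of_not_mem hex f, sec_insert_of_not_mem hex g, sec_insert_insert e f,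
    sec_insert_insert e g, sec_insert_of_not_mem heKx g, sec_insert_insert e g]
  rw [osT_pivot p hH he (sec K x f) (sec K (K \ x) g),
    osD_pivot p hH he (sec K x f * (sec K x g - sec K (K \ x) g))]
  rw [sec_comp_insert heK f, sec_comp_sdiff hex f, sec_comp_insert heK g, sec_comp_sdiff heKx g]
  simp only [Pi.mul_apply, Pi.mul_def, Pi.sub_def]
  simp only [sec_apply_insert heK, sec_apply_sdiff hex, sec_apply_sdiff heKx]
  rw [osD_sub_mul_sub]
  simp only [osD_mul_sub]
  ring

/-- **(†)**: `P_{K∪{e}}(f,g) = P_K(f¹,g⁰) + P_K(f⁰,g¹) + Σ_{x⊆K} D(u^x v^x)` with `u^x = f^{x,1} − f^{x,0}`, `v^x = g^{x,1} − g^{x,0}`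
(`e ∉ K`; pure bilinear algebra, any `H`). [this work] -/
theorem osP_insert_eq (p : ι → unitInterval) (H : Set (Set ι)) {K : Finset ι} {e : ι} (heK : e ∉ K)
    (f g : Set ι → ℝ) :
    osP p H (insert e K) f g =
      osP p H K (fun ω => f (insert e ω)) (fun ω => g (ω \ {e}))
      + osP p H K (fun ω => f (ω \ {e})) (fun ω => g (insert e ω))
      + ∑ x ∈ K.powerset, osD p H (fun ω =>
          (sec K x (fun ω => f (insert e ω)) ω - sec K x (fun ω => f (ω \ {e})) ω) *
            (sec K x (fun ω => g (insert e ω)) ω - sec K x (fun ω => g (ω \ {e})) ω)) := by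
  unfold osP
  have hdisj : Disjoint K.powerset (K.powerset.image (insert e)) := by
    rw [Finset.disjoint_left]
    intro x hx hx'
    obtain ⟨y, -, rfl⟩ := Finset.mem_image.1 hx'
    exact heK (Finset.mem_powerset.1 hx (Finset.mem_insert_self e y))
  have hinj : Set.InjOn (insert e) (K.powerset : Set (Finset ι)) := by
    intro x hx y hy hxy
    have hxe : e ∉ x := fun h => heK (Finset.mem_powerset.1 (Finset.mem_coe.1 hx) h)
    have hye : e ∉ y := fun h => heK (Finset.mem_powerset.1 (Finset.mem_coe.1 hy) h)
    rw [← Finset.erase_insert hxe, hxy, Finset.erase_insert hye]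
  rw [Finset.powerset_insert, Finset.sum_union hdisj, Finset.sum_image hinj, ← Finset.sum_add_distrib,
    ← Finset.sum_add_distrib, ← Finset.sum_add_distrib]
  refine Finset.sum_congr rfl fun x hx => ?_
  have hxK : x ⊆ K := Finset.mem_powerset.1 hx
  have hex : e ∉ x := fun h => heK (hxK h)
  have heKx : e ∉ K \ x := fun h => heK (Finset.sdiff_subset h)
  have hc1 : insert e K \ x = insert e (K \ x) := Finset.insert_sdiff_of_notMem K hex
  have hc2 : insert e K \ insert e x = K \ x := by
    ext i
    simp only [Finset.mem_sdiff, Finset.mem_insert]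
    constructor
    · rintro ⟨h | h, h2⟩
      · exact absurd (Or.inl h) h2
      · exact ⟨h, fun h3 => h2 (Or.inr h3)⟩
    · rintro ⟨h1, h2⟩
      exact ⟨Or.inr h1, fun h3 => h3.elim (fun h4 => heK (h4 ▸ h1)) h2⟩
  rw [hc1, hc2, sec_insert_of_not_mem hex f, sec_insert_of_not_mem hex g, sec_insert_insert e f,
    sec_insert_insert e g, sec_insert_of_not_mem heKx g, sec_insert_insert e g]
  simp only [Pi.mul_def, Pi.sub_def]
  rw [osD_sub_mul_sub]
  simp only [osD_mul_sub]
  ring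

/-- The same splitting for the main part `M`: `M_{K∪{e}}(f,g) − M_K(f¹,g⁰) − M_K(f⁰,g¹) = Σ_{x⊆K} m′(u^x, v^x)`, stated as the
identity `Σ_x [m′(f^{x1},g^{x1}) + m′(f^{x0},g^{x0})] = Σ_x [m′(f^{x1},g^{x0}) + m′(f^{x0},g^{x1}) + m′(u^x,v^x)]` term by term
(bilinearity of `m′`; the `n`-terms coincide). [this work] -/
theorem osM_insert_eq (p : ι → unitInterval) (H : Set (Set ι)) {K : Finset ι} {e : ι} (heK : e ∉ K)
    (f g : Set ι → ℝ) :
    osM p H (insert e K) f g =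
      osM p H K (fun ω => f (insert e ω)) (fun ω => g (ω \ {e}))
      + osM p H K (fun ω => f (ω \ {e})) (fun ω => g (insert e ω))
      + ∑ x ∈ K.powerset, osMp p H
          (fun ω => sec K x (fun ω => f (insert e ω)) ω - sec K x (fun ω => f (ω \ {e})) ω)
          (fun ω => sec K x (fun ω => g (insert e ω)) ω - sec K x (fun ω => g (ω \ {e})) ω) := by
  unfold osM
  have hdisj : Disjoint K.powerset (K.powerset.image (insert e)) := by
    rw [Finset.disjoint_left]
    intro x hx hx'
    obtain ⟨y, -, rfl⟩ := Finset.mem_image.1 hx'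
    exact heK (Finset.mem_powerset.1 hx (Finset.mem_insert_self e y))
  have hinj : Set.InjOn (insert e) (K.powerset : Set (Finset ι)) := by
    intro x hx y hy hxy
    have hxe : e ∉ x := fun h => heK (Finset.mem_powerset.1 (Finset.mem_coe.1 hx) h)
    have hye : e ∉ y := fun h => heK (Finset.mem_powerset.1 (Finset.mem_coe.1 hy) h)
    rw [← Finset.erase_insert hxe, hxy, Finset.erase_insert hye]
  rw [Finset.powerset_insert, Finset.sum_union hdisj, Finset.sum_image hinj, ← Finset.sum_add_distrib,
    ← Finset.sum_add_distrib, ← Finset.sum_add_distrib]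
  refine Finset.sum_congr rfl fun x hx => ?_
  have hxK : x ⊆ K := Finset.mem_powerset.1 hx
  have hex : e ∉ x := fun h => heK (hxK h)
  have heKx : e ∉ K \ x := fun h => heK (Finset.sdiff_subset h)
  have hc1 : insert e K \ x = insert e (K \ x) := Finset.insert_sdiff_of_notMem K hex
  have hc2 : insert e K \ insert e x = K \ x := by
    ext i
    simp only [Finset.mem_sdiff, Finset.mem_insert]
    constructor
    · rintro ⟨h | h, h2⟩
      · exact absurd (Or.inl h) h2
      · exact ⟨h, fun h3 => h2 (Or.inr h3)⟩
    · rintro ⟨h1, h2⟩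
      exact ⟨Or.inr h1, fun h3 => h3.elim (fun h4 => heK (h4 ▸ h1)) h2⟩
  rw [hc1, hc2, sec_insert_of_not_mem hex f, sec_insert_of_not_mem hex g, sec_insert_insert e f,
    sec_insert_insert e g, sec_insert_of_not_mem heKx g, sec_insert_insert e g]
  -- everything in terms of `ex`-atoms
  unfold osMp osN osCert
  simp only [osD_eq]
  -- name the four section functions and expand products of differences
  set φ₁ := sec K x (fun ω => f (insert e ω)) with hφ₁
  set φ₀ := sec K x (fun ω => f (ω \ {e})) with hφ₀
  set ψ₁ := sec K x (fun ω => g (insert e ω)) with hψ₁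
  set ψ₀ := sec K x (fun ω => g (ω \ {e})) with hψ₀
  set χ₁ := sec K (K \ x) (fun ω => g (insert e ω)) with hχ₁
  set χ₀ := sec K (K \ x) (fun ω => g (ω \ {e})) with hχ₀
  set μ := bernoulliWeight p with hμ
  have e1 : ex μ (ind H * fun ω => φ₁ ω - φ₀ ω) = ex μ (ind H * φ₁) - ex μ (ind H * φ₀) := by
    rw [ex_congr' (fun ω => show (ind H * fun ω => φ₁ ω - φ₀ ω) ω = 1 * (ind H * φ₁) ω + (-1) * (ind H * φ₀) ω from by
      simp only [Pi.mul_apply]; ring), ex_lin2]; ring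
  have e2 : ex μ (ind H * fun ω => ψ₁ ω - ψ₀ ω) = ex μ (ind H * ψ₁) - ex μ (ind H * ψ₀) := by
    rw [ex_congr' (fun ω => show (ind H * fun ω => ψ₁ ω - ψ₀ ω) ω = 1 * (ind H * ψ₁) ω + (-1) * (ind H * ψ₀) ω from by
      simp only [Pi.mul_apply]; ring), ex_lin2]; ring
  have e3 : ex μ (ind H * (fun ω => φ₁ ω - φ₀ ω) * fun ω => ψ₁ ω - ψ₀ ω) =
      ex μ (ind H * φ₁ * ψ₁) - ex μ (ind H * φ₁ * ψ₀) - ex μ (ind H * φ₀ * ψ₁) + ex μ (ind H * φ₀ * ψ₀) := by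
    rw [ex_congr' (fun ω => show (ind H * (fun ω => φ₁ ω - φ₀ ω) * fun ω => ψ₁ ω - ψ₀ ω) ω =
      1 * (ind H * φ₁ * ψ₁) ω + (-1) * (ind H * φ₁ * ψ₀) ω + (-1) * (ind H * φ₀ * ψ₁) ω + 1 * (ind H * φ₀ * ψ₀) ω from by
      simp only [Pi.mul_apply]; ring), ex_lin4]; ring
  have e4 : ex μ (ind H * ((fun ω => φ₁ ω - φ₀ ω) * fun ω => ψ₁ ω - ψ₀ ω)) =
      ex μ (ind H * φ₁ * ψ₁) - ex μ (ind H * φ₁ * ψ₀) - ex μ (ind H * φ₀ * ψ₁) + ex μ (ind H * φ₀ * ψ₀) := by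
    rw [← e3, mul_assoc]
  have e5 : ex μ ((fun ω => φ₁ ω - φ₀ ω) * fun ω => ψ₁ ω - ψ₀ ω) =
      ex μ (φ₁ * ψ₁) - ex μ (φ₁ * ψ₀) - ex μ (φ₀ * ψ₁) + ex μ (φ₀ * ψ₀) := by
    rw [ex_congr' (fun ω => show ((fun ω => φ₁ ω - φ₀ ω) * fun ω => ψ₁ ω - ψ₀ ω) ω =
      1 * (φ₁ * ψ₁) ω + (-1) * (φ₁ * ψ₀) ω + (-1) * (φ₀ * ψ₁) ω + 1 * (φ₀ * ψ₀) ω from by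
      simp only [Pi.mul_apply]; ring), ex_lin4]; ring
  have m1 : ∀ a b : Set ι → ℝ, ex μ (ind H * (a * b)) = ex μ (ind H * a * b) := fun a b => by rw [mul_assoc]
  simp only [m1] at *
  rw [e1, e2, e4, e5]
  ring

end SahiOneStep

end Summit.CriticalPhenomena.PercolationContinuityZ3.Theorems
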